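import Summits.CriticalPhenomena.PercolationContinuityZ3.Theorems.PercNearOneGluingNoHeavyLowerTailSahiCombTensorisation
import Summits.CriticalPhenomena.PercolationContinuityZ3.Theorems.PercNearOneGluingNoHeavyLowerTailSahiCombCylinder
import Summits.CriticalPhenomena.PercolationContinuityZ3.Theorems.PercNearOneGluingNoHeavyLowerTailSahiCombMeetAbsorbing

/-!
# The comb (tensor-Bernstein) hierarchy for Sahi's `E_k`, XI: two UNCONDITIONAL rows from tensorisation — crossed chains (every order) and
# two independent groups of at most two slots

Support file of the one-cut programme (crux `NoHeavyLowerTail`, stmt-CriticalPhenomena-4575; cell `prim-masterthm`, seat P3, gen 3;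
`run/shared/lean/prim/prim-masterthm/prim-masterthm-p3/HIERARCHY.md` §10).  Companion of `…SahiCombTensorisation`
(`combPos_sahiE_ind_separable_local`: comb positivity of a separable family `U_i = V_i ∩ W_i`, `V_i` determined by `F`, `W_i` by `Fᶜ`, from
comb positivity of the sub-families of `V` and of the block-intersection families of `W`).  Feeding it the tree's unconditional all-order rows:
* `combPos_sahiE_ind_of_crossedChains` — **for every `n`, `E_n` of `U_i = V_i ∩ W_i` with `(V_i)` a chain of increasing events determined
  by `F` and `(W_i)` a chain of increasing events determined by `Fᶜ` (each pairwise comparable, in ANY two orders along `i` — so `U` need not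
  be a chain) is comb-positive at multidegree `n`** (sub-families and block intersections of a chain are chains;
  `combPos_sahiE_ind_of_chain` of `…SahiCombMeetAbsorbing`);
* `combPos_sahiE_ind_of_blocks_offTwo` — **for every `n`, two independent groups of slots each containing at most two NON-CYLINDER members:
  `E_n` comb-positive** (comb-Blinovsky offTwo ⊗ offTwo: both tensor factors have at most two non-cylinder members,
  `combPos_sahiE_ind_of_allButTwoCylinders` of `…SahiCombCylinder`); corollary `combPos_sahiE_ind_of_smallBlocks` — two independent groups
  of at most two slots each, in particular `E_4(A, B, C, D)` whenever `{A, B}` and `{C, D}` are determined by disjoint coordinate sets;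
* law-level shadows `sahiE_ind_nonneg_of_crossedChains`, `sahiE_ind_nonneg_of_blocks_offTwo`, `sahiE_ind_nonneg_of_smallBlocks` (Sahi's `E_n ≥ 0` there, every `p ∈ [0,1]^ι`).
HONEST FRAMING: nothing here asserts (M⁺-k) or `C_k` for `k ≥ 3`. [this work]
-/

noncomputable section

open scoped Classical

namespace Summit.CriticalPhenomena.PercolationContinuityZ3.Theorems

open Finset Function
open Literature.Combinatorics.Sahi2008
open Literature.Combinatorics.Sahi2008.PartitionForm
open Literature.Probability.Percolation (DeterminedBy determinedBy_iff determinedBy_univ)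
open Literature.Probability.Percolation.DecisionTree (ind ind_of_mem ind_of_not_mem ind_nonneg)
open SahiComb SahiTotalCumulance

namespace SahiCombTensor

variable {ι : Type} [Fintype ι]

/-! ### Unconditional rows -/

omit [Fintype ι] in
/-- The intersection of a nonempty finite chain is one of its members. [folklore] -/
theorem exists_iInter_eq_of_chain : ∀ (m : ℕ) (X : Fin (m + 1) → Set (Set ι)),
    (∀ i j, X i ⊆ X j ∨ X j ⊆ X i) → ∃ j, (⋂ i, X i) = X j
  | 0, X, _ => ⟨0, by
      ext ω; simp only [Set.mem_iInter]
      exact ⟨fun h => h 0, fun h i => by rwa [Subsingleton.elim (α := Fin 1) i 0]⟩⟩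
  | m + 1, X, hX => by
    obtain ⟨j, hj⟩ := exists_iInter_eq_of_chain m (Fin.tail X) fun i j => hX _ _
    have hsplit : (⋂ i, X i) = X 0 ∩ ⋂ i, Fin.tail X i := by
      ext ω
      simp only [Set.mem_iInter, Set.mem_inter_iff, Fin.tail]
      constructor
      · intro h; exact ⟨h 0, fun i => h _⟩
      · rintro ⟨h0, h⟩ i
        refine Fin.cases h0 (fun i => h i) i
    rw [hsplit, hj]
    rcases hX 0 j.succ with h | h
    · exact ⟨0, Set.inter_eq_left.2 h⟩
    · exact ⟨j.succ, Set.inter_eq_right.2 h⟩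

omit [Fintype ι] in
/-- The intersection of a finite chain (possibly empty: `= univ`) is comparable with every member-intersection of the same chain. [folklore] -/
theorem iInter_subset_or_of_chain {N : ℕ} (W : Fin N → Set (Set ι)) (hW : ∀ i j, W i ⊆ W j ∨ W j ⊆ W i)
    {m m' : ℕ} (a : Fin m → Fin N) (a' : Fin m' → Fin N) :
    (⋂ i, W (a i)) ⊆ (⋂ i, W (a' i)) ∨ (⋂ i, W (a' i)) ⊆ (⋂ i, W (a i)) := by
  cases m' with
  | zero => left; intro ω _; simp
  | succ m' =>
    cases m with
    | zero => right; intro ω _; simp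
    | succ m =>
      obtain ⟨j, hj⟩ := exists_iInter_eq_of_chain m (fun i => W (a i)) fun i j => hW _ _
      obtain ⟨j', hj'⟩ := exists_iInter_eq_of_chain m' (fun i => W (a' i)) fun i j => hW _ _
      rw [hj, hj']
      exact hW _ _

/-- **CROSSED CHAINS are comb-positive at every order, unconditionally.**  Let `(V_i)` be a chain of increasing events determined by `F` and
`(W_i)` a chain of increasing events determined by `Fᶜ` (each family pairwise comparable, in any order along `i`).  Then for every `n`,
`p ↦ E_{n+1}(μ_p; 1_{V_0 ∩ W_0},…,1_{V_n ∩ W_n})` is a nonnegative combination of the degree-`(n+1)` tensor-Bernstein basis. [this work] -/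
theorem combPos_sahiE_ind_of_crossedChains (F : Finset ι) {n : ℕ} (V W : Fin (n + 1) → Set (Set ι))
    (hVu : ∀ i, IsUpperSet (V i)) (hWu : ∀ i, IsUpperSet (W i))
    (hV : ∀ i, DeterminedBy (V i) (↑F : Set ι)) (hW : ∀ i, DeterminedBy (W i) (↑F : Set ι)ᶜ)
    (hVc : ∀ i j, V i ⊆ V j ∨ V j ⊆ V i) (hWc : ∀ i j, W i ⊆ W j ∨ W j ⊆ W i) :
    CombPos (fun _ : ι => n + 1) (fun p => sahiE (bernoulliWeight p) (n + 1) (fun i => ind (V i ∩ W i))) := by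
  refine combPos_sahiE_ind_separable_local F V W hV hW (fun B => ?_) fun c => ?_
  · exact combPos_sahiE_ind_of_chain _ (fun j => hVu _) fun i j => hVc _ _
  · exact combPos_sahiE_ind_of_chain _ (fun m => isUpperSet_blockInter hWu c m) fun m m' =>
      iInter_subset_or_of_chain W hWc _ _

/-- Law-level shadow: `E_{n+1}(μ_p) ≥ 0` on crossed chains, every `p ∈ [0,1]^ι`. [this work] -/
theorem sahiE_ind_nonneg_of_crossedChains (p : ι → unitInterval) (F : Finset ι) {n : ℕ} (V W : Fin (n + 1) → Set (Set ι))
    (hVu : ∀ i, IsUpperSet (V i)) (hWu : ∀ i, IsUpperSet (W i))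
    (hV : ∀ i, DeterminedBy (V i) (↑F : Set ι)) (hW : ∀ i, DeterminedBy (W i) (↑F : Set ι)ᶜ)
    (hVc : ∀ i j, V i ⊆ V j ∨ V j ⊆ V i) (hWc : ∀ i j, W i ⊆ W j ∨ W j ⊆ W i) :
    0 ≤ sahiE (bernoulliWeight p) (n + 1) (fun i => ind (V i ∩ W i)) :=
  (combPos_sahiE_ind_of_crossedChains F V W hVu hWu hV hW hVc hWc).nonneg p

omit [Fintype ι] in
/-- A finite intersection of cylinders `{ω | S_j ⊆ ω}` is the cylinder of the union. [folklore] -/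
theorem exists_iInter_eq_cylinder {m : ℕ} (X : Fin m → Set (Set ι)) (h : ∀ j, ∃ S : Set ι, X j = {ω : Set ι | S ⊆ ω}) :
    ∃ S : Set ι, (⋂ j, X j) = {ω : Set ι | S ⊆ ω} := by
  choose S hS using h
  refine ⟨⋃ j, S j, ?_⟩
  ext ω
  simp only [Set.mem_iInter, hS, Set.mem_setOf_eq, Set.iUnion_subset_iff]

/-- **Two independent groups, each with at most two NON-CYLINDER members, are comb-positive — unconditionally, every order.**  Let the members
`U_i` with `b i` be determined by `F` and the others by `Fᶜ`; suppose that outside an index set `E` every member is a cylinder `{ω | S ⊆ ω}`, and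
that `E` contains at most two indices of each group.  Then `p ↦ E_{n+1}(μ_p; 1_U)` is comb-positive at multidegree `n + 1`.  (Both tensor factors
— the sub-families of the first group padded with `univ`, and the block intersections of the second — have at most two non-cylinder members, so
`combPos_sahiE_ind_of_allButTwoCylinders` of `…SahiCombCylinder` applies to each; comb-Blinovsky offTwo ⊗ offTwo.) [this work] -/
theorem combPos_sahiE_ind_of_blocks_offTwo (F : Finset ι) {n : ℕ} (U : Fin (n + 1) → Set (Set ι)) (hU : ∀ i, IsUpperSet (U i))
    (b : Fin (n + 1) → Prop) (hb : ∀ i, b i → DeterminedBy (U i) (↑F : Set ι)) (hb' : ∀ i, ¬ b i → DeterminedBy (U i) (↑F : Set ι)ᶜ)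
    (E : Finset (Fin (n + 1))) (hE : (E.filter fun i => b i).card ≤ 2) (hE' : (E.filter fun i => ¬ b i).card ≤ 2)
    (hcyl : ∀ i, i ∉ E → ∃ S : Set ι, U i = {ω : Set ι | S ⊆ ω}) :
    CombPos (fun _ : ι => n + 1) (fun p => sahiE (bernoulliWeight p) (n + 1) (fun i => ind (U i))) := by
  set V : Fin (n + 1) → Set (Set ι) := fun i => if b i then U i else Set.univ with hVdef
  set W : Fin (n + 1) → Set (Set ι) := fun i => if b i then Set.univ else U i with hWdef
  have hV : ∀ i, DeterminedBy (V i) (↑F : Set ι) := fun i => by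
    by_cases hi : b i <;> simp only [hVdef, hi, if_true, if_false, hb i, determinedBy_univ]
  have hW : ∀ i, DeterminedBy (W i) (↑F : Set ι)ᶜ := fun i => by
    by_cases hi : b i <;> simp only [hWdef, hi, if_true, if_false, hb' i, determinedBy_univ, not_false_eq_true]
  have hVu : ∀ i, IsUpperSet (V i) := fun i => by by_cases hi : b i <;> simp only [hVdef, hi, if_true, if_false, hU i, isUpperSet_univ]
  have hWu : ∀ i, IsUpperSet (W i) := fun i => by by_cases hi : b i <;> simp only [hWdef, hi, if_true, if_false, hU i, isUpperSet_univ]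
  have huniv : (Set.univ : Set (Set ι)) = {ω : Set ι | (∅ : Set ι) ⊆ ω} := by ext ω; simp
  -- every `V_i` / `W_i` off the exceptional indices of its group is a cylinder
  have hVcyl : ∀ i, ¬ (b i ∧ i ∈ E) → ∃ S : Set ι, V i = {ω : Set ι | S ⊆ ω} := fun i hi => by
    by_cases hbi : b i
    · obtain ⟨S, hS⟩ := hcyl i fun hiE => hi ⟨hbi, hiE⟩
      exact ⟨S, by simp only [hVdef, hbi, if_true, hS]⟩
    · exact ⟨∅, by simp only [hVdef, hbi, if_false, huniv]⟩
  have hWcyl : ∀ i, ¬ (¬ b i ∧ i ∈ E) → ∃ S : Set ι, W i = {ω : Set ι | S ⊆ ω} := fun i hi => by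
    by_cases hbi : b i
    · exact ⟨∅, by simp only [hWdef, hbi, if_true, huniv]⟩
    · obtain ⟨S, hS⟩ := hcyl i fun hiE => hi ⟨hbi, hiE⟩
      exact ⟨S, by simp only [hWdef, hbi, if_false, hS]⟩
  have h := combPos_sahiE_ind_separable_local F V W hV hW (fun B => ?_) fun c => ?_
  · refine h.congr fun p => ?_
    congr 1
    funext i
    by_cases hi : b i <;> simp [hVdef, hWdef, hi]
  · -- the `V`-sub-family along `B`: exceptional members inject into `E.filter b`
    refine combPos_sahiE_ind_of_allButTwoCylinders _ _ (fun j => hVu _)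
      ⟨univ.filter fun j => b (B.orderEmbOfFin rfl j) ∧ B.orderEmbOfFin rfl j ∈ E, ?_, fun j hj => hVcyl _ fun h' =>
        hj (Finset.mem_filter.2 ⟨mem_univ _, h'⟩)⟩
    calc (univ.filter fun j : Fin B.card => b (B.orderEmbOfFin rfl j) ∧ B.orderEmbOfFin rfl j ∈ E).card
        ≤ (E.filter fun i => b i).card := by
          refine Finset.card_le_card_of_injOn (fun j => B.orderEmbOfFin rfl j) (fun j hj => ?_) fun a _ a' _ haa' => ?_
          · have h' := (Finset.mem_filter.1 (Finset.mem_coe.1 hj)).2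
            exact Finset.mem_coe.2 (Finset.mem_filter.2 ⟨h'.2, h'.1⟩)
          · exact (B.orderEmbOfFin rfl).injective haa'
      _ ≤ 2 := hE
  · -- the block-intersection family: exceptional blocks contain a `¬ b` slot of `E`; choosing one is an injection into `E.filter (¬ b ·)`
    refine combPos_sahiE_ind_of_allButTwoCylinders _ _ (fun m => isUpperSet_blockInter hWu c m)
      ⟨univ.filter fun m => ∃ x ∈ block c m, ¬ b x ∧ x ∈ E, ?_, fun m hm => ?_⟩
    · let f : Fin c.length → Fin (n + 1) := fun m => if h : ∃ x ∈ block c m, ¬ b x ∧ x ∈ E then h.choose else 0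
      calc (univ.filter fun m => ∃ x ∈ block c m, ¬ b x ∧ x ∈ E).card ≤ (E.filter fun i => ¬ b i).card := by
            refine Finset.card_le_card_of_injOn f (fun m hm => ?_) fun m hm m' hm' hmm' => ?_
            · have h' : ∃ x ∈ block c m, ¬ b x ∧ x ∈ E := (Finset.mem_filter.1 (Finset.mem_coe.1 hm)).2
              have hf : f m = h'.choose := dif_pos h'
              exact Finset.mem_coe.2 (Finset.mem_filter.2 ⟨hf ▸ h'.choose_spec.2.2, hf ▸ h'.choose_spec.2.1⟩)
            · have h1 : ∃ x ∈ block c m, ¬ b x ∧ x ∈ E := (Finset.mem_filter.1 (Finset.mem_coe.1 hm)).2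
              have h1' : ∃ x ∈ block c m', ¬ b x ∧ x ∈ E := (Finset.mem_filter.1 (Finset.mem_coe.1 hm')).2
              have hf : f m = h1.choose := dif_pos h1
              have hf' : f m' = h1'.choose := dif_pos h1'
              have hx : h1.choose ∈ block c m := h1.choose_spec.1
              have hx' : h1'.choose ∈ block c m' := h1'.choose_spec.1
              rw [← index_eq_of_mem_block c hx, ← index_eq_of_mem_block c hx', ← hf, ← hf', hmm']
        _ ≤ 2 := hE'
    · refine exists_iInter_eq_cylinder _ fun j => hWcyl _ fun h' => hm (Finset.mem_filter.2 ⟨mem_univ _, ?_⟩)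
      exact ⟨_, Finset.orderEmbOfFin_mem _ _ j, h'⟩

/-- Law-level shadow: `E_{n+1}(μ_p; 1_U) ≥ 0` for two independent groups with at most two non-cylinder members each. [this work] -/
theorem sahiE_ind_nonneg_of_blocks_offTwo (p : ι → unitInterval) (F : Finset ι) {n : ℕ} (U : Fin (n + 1) → Set (Set ι))
    (hU : ∀ i, IsUpperSet (U i)) (b : Fin (n + 1) → Prop) (hb : ∀ i, b i → DeterminedBy (U i) (↑F : Set ι))
    (hb' : ∀ i, ¬ b i → DeterminedBy (U i) (↑F : Set ι)ᶜ) (E : Finset (Fin (n + 1))) (hE : (E.filter fun i => b i).card ≤ 2)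
    (hE' : (E.filter fun i => ¬ b i).card ≤ 2) (hcyl : ∀ i, i ∉ E → ∃ S : Set ι, U i = {ω : Set ι | S ⊆ ω}) :
    0 ≤ sahiE (bernoulliWeight p) (n + 1) (fun i => ind (U i)) :=
  (combPos_sahiE_ind_of_blocks_offTwo F U hU b hb hb' E hE hE' hcyl).nonneg p

/-- **Two independent groups of at most two slots each are comb-positive, unconditionally** (every `n`; nontrivial for `n + 1 ≤ 4`): if the
members with `b i` (at most two of them) are determined by `F` and the others (at most two) by `Fᶜ`, then `p ↦ E_{n+1}(μ_p; 1_U)` is comb-positive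
at multidegree `n + 1`.  In particular `E_4(A, B, C, D)` is comb-positive whenever `{A, B}` and `{C, D}` are determined by disjoint coordinate sets.
[this work] -/
theorem combPos_sahiE_ind_of_smallBlocks (F : Finset ι) {n : ℕ} (U : Fin (n + 1) → Set (Set ι)) (hU : ∀ i, IsUpperSet (U i))
    (b : Fin (n + 1) → Prop) (hb : ∀ i, b i → DeterminedBy (U i) (↑F : Set ι)) (hb' : ∀ i, ¬ b i → DeterminedBy (U i) (↑F : Set ι)ᶜ)
    (h2 : (univ.filter fun i => b i).card ≤ 2) (h2' : (univ.filter fun i => ¬ b i).card ≤ 2) :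
    CombPos (fun _ : ι => n + 1) (fun p => sahiE (bernoulliWeight p) (n + 1) (fun i => ind (U i))) :=
  combPos_sahiE_ind_of_blocks_offTwo F U hU b hb hb' univ h2 h2' fun i hi => absurd (mem_univ i) hi

/-- Law-level shadow: `E_{n+1}(μ_p; 1_U) ≥ 0` for two independent groups of at most two slots each; e.g. Sahi's `E_4(A,B,C,D) ≥ 0` for
`{A, B}` independent of `{C, D}`. [this work] -/
theorem sahiE_ind_nonneg_of_smallBlocks (p : ι → unitInterval) (F : Finset ι) {n : ℕ} (U : Fin (n + 1) → Set (Set ι))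
    (hU : ∀ i, IsUpperSet (U i)) (b : Fin (n + 1) → Prop) (hb : ∀ i, b i → DeterminedBy (U i) (↑F : Set ι))
    (hb' : ∀ i, ¬ b i → DeterminedBy (U i) (↑F : Set ι)ᶜ)
    (h2 : (univ.filter fun i => b i).card ≤ 2) (h2' : (univ.filter fun i => ¬ b i).card ≤ 2) :
    0 ≤ sahiE (bernoulliWeight p) (n + 1) (fun i => ind (U i)) :=
  (combPos_sahiE_ind_of_smallBlocks F U hU b hb hb' h2 h2').nonneg p

end SahiCombTensor

end Summit.CriticalPhenomena.PercolationContinuityZ3.Theorems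

end
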